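import Summits.Ventures.PercRepro.MSTightHalves

/-!
# Tight families are interval-hereditary

Both halves of a tight family are tight (`MSTightHalves.lean`). Iterating: the members of a tight
family avoiding a set `Z` form a tight family (`tight_filter_disjoint`), the members containing a
set `Z` form a tight family (`tight_filter_subset_left`), and hence so do the members lying in
any interval `[x, y]` (`tight_filter_interval`) — Corollary (iii) of proofs/MINE1-theoremS.md in
full: every restriction `F ∩ 2^y`, `F ∩ {t ⊇ x}`, `F ∩ [x, y]` of a tight family is tight.
-/

namespace PercRepro.MSTight

open Finset
open scoped FinsetFamily

variable {α : Type*} [DecidableEq α]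

/-- The members containing `r` avoid `r` in their differences, so `partr r F` (with `r` erased)
has exactly the differences of the members containing `r`. -/
theorem diffs_partr_eq_diffs_filter (r : α) (F : Finset (Finset α)) :
    partr r F \\ partr r F = (F.filter fun A => r ∈ A) \\ (F.filter fun A => r ∈ A) := by
  ext E
  simp only [mem_diffs, partr, mem_image, mem_filter]
  constructor
  · rintro ⟨_, ⟨A, ⟨hA, hrA⟩, rfl⟩, _, ⟨B, ⟨hB, hrB⟩, rfl⟩, rfl⟩
    refine ⟨A, ⟨hA, hrA⟩, B, ⟨hB, hrB⟩, ?_⟩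
    rw [erase_sdiff_erase, erase_eq_of_notMem]
    exact fun h => (mem_sdiff.1 h).2 hrB
  · rintro ⟨A, ⟨hA, hrA⟩, B, ⟨hB, hrB⟩, rfl⟩
    refine ⟨A.erase r, ⟨A, ⟨hA, hrA⟩, rfl⟩, B.erase r, ⟨B, ⟨hB, hrB⟩, rfl⟩, ?_⟩
    rw [erase_sdiff_erase, erase_eq_of_notMem]
    exact fun h => (mem_sdiff.1 h).2 hrB

/-- `partr r F` has as many members as there are members containing `r`. -/
theorem card_partr_eq_card_filter (r : α) (F : Finset (Finset α)) :
    (partr r F).card = (F.filter fun A => r ∈ A).card := by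
  unfold partr
  apply card_image_of_injOn
  intro A hA B hB hAB
  simp only [coe_filter, Set.mem_setOf_eq] at hA hB
  have hAB' : A.erase r = B.erase r := hAB
  rw [← insert_erase hA.2, ← insert_erase hB.2, hAB']

/-- The members containing `r` are tight iff `partr r F` is. -/
theorem tight_filter_mem_iff_tight_partr (r : α) (F : Finset (Finset α)) :
    Tight (F.filter fun A => r ∈ A) ↔ Tight (partr r F) := by
  unfold Tight
  rw [diffs_partr_eq_diffs_filter, card_partr_eq_card_filter]

variable [Fintype α]

/-- **Members avoiding a set are tight.** -/
theorem tight_filter_disjoint {F : Finset (Finset α)} (hF : Tight F) (Z : Finset α) :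
    Tight (F.filter fun t => Disjoint t Z) := by
  induction Z using Finset.induction_on with
  | empty => simpa using hF
  | insert r Z _ ih =>
    have e : (F.filter fun t => Disjoint t (insert r Z)) = part0 r (F.filter fun t => Disjoint t Z) := by
      ext t
      simp only [mem_filter, mem_part0, Finset.disjoint_insert_right]
      tauto
    rw [e]
    exact (tight_part0_and_tight_partr ih r).1

/-- **Members containing a set are tight.** -/
theorem tight_filter_subset_left {F : Finset (Finset α)} (hF : Tight F) (Z : Finset α) :
    Tight (F.filter fun t => Z ⊆ t) := by
  induction Z using Finset.induction_on with
  | empty => simpa using hF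
  | insert r Z _ ih =>
    have e : (F.filter fun t => insert r Z ⊆ t) = (F.filter fun t => Z ⊆ t).filter fun t => r ∈ t := by
      ext t
      simp only [mem_filter, Finset.insert_subset_iff]
      tauto
    rw [e, tight_filter_mem_iff_tight_partr]
    exact (tight_part0_and_tight_partr ih r).2

/-- **Members inside a set are tight**: `F ∩ 2^y` is tight. -/
theorem tight_filter_subset_right {F : Finset (Finset α)} (hF : Tight F) (y : Finset α) :
    Tight (F.filter fun t => t ⊆ y) := by
  have e : (F.filter fun t => t ⊆ y) = F.filter fun t => Disjoint t (Finset.univ \ y) := by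
    ext t
    simp only [mem_filter]
    constructor
    · rintro ⟨ht, hty⟩
      exact ⟨ht, disjoint_left.2 fun x hx hx' => (mem_sdiff.1 hx').2 (hty hx)⟩
    · rintro ⟨ht, hd⟩
      refine ⟨ht, fun x hx => ?_⟩
      by_contra hxy
      exact disjoint_left.1 hd hx (mem_sdiff.2 ⟨mem_univ _, hxy⟩)
  rw [e]
  exact tight_filter_disjoint hF _

/-- **Tight families are interval-hereditary**: the members of a tight family lying in an
interval `[x, y]` form a tight family. -/
theorem tight_filter_interval {F : Finset (Finset α)} (hF : Tight F) (x y : Finset α) :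
    Tight (F.filter fun t => x ⊆ t ∧ t ⊆ y) := by
  have := tight_filter_subset_right (tight_filter_subset_left hF x) y
  rwa [Finset.filter_filter] at this

end PercRepro.MSTight
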